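import Summits.Ventures.HSemireg.PerfectComplexDoor
import Literature.AlgebraicGeometry.Motives.AbelianVarietyCohomologyExteriorH1
import Literature.AlgebraicGeometry.Modules.LinearOverBase
import Mathlib.Algebra.Homology.DerivedCategory.Linear
import Mathlib.LinearAlgebra.CliffordAlgebra.Contraction
import Mathlib.LinearAlgebra.Dimension.Basic
import HarnessLib

/-!
# Venture HSemireg — the perfect-complex door with a REAL admissibility notion on abelian fibres:
# «`Ext^{<0}(E,E) = 0`, `Hom(E,E) = ℂ`, and `rank Ext²(E,E) ≤ r(A, ch E)`», `r` the rank of the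
# polyvector contraction `HT²(A) → H^•(A)`, `ξ ↦ ξ ⌟ ch(E)` (Buchweitz–Flenner 2008, Prop. 6.4.4)

HONEST FRAMING. Part of the Lean index of the computation cell `pub-hsemireg` (seat p4; TIER 2 of
`PerfectComplexDoor.lean`, recommended by theory seat 2 on the cell bus 2026-08-22T11:49Z/11:56Z). Nothing here
is a claim about any explicit variety; nothing here says that HC / HC_CM / HC_AV holds; no Literature fact is
declared. This file REPLACES the opaque parameter `Adm` of `PerfectComplexDoor.lean` by ONE admissibility notion
`rankAdmissible C` all of whose conjuncts are definitions on REAL carriers of the tree and of Mathlib, and names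
the corresponding transfer statement `PerfectComplexRankTransfer C := PerfectComplexVariationalHodge C
(rankAdmissible C)`. That statement remains an ASSUMPTION BY NAME (a hypothesis of the cell's assembly theorem,
seat p7), exactly as declared in `PerfectComplexDoor.lean` item 4 — what changes is that the object class is now
a specific, non-vacuous mathematical predicate which the cell's census instantiates BY VALUE (`18 = 18` at
`g = 4`, `48 = 48` at `g = 6`, see below), instead of a schema.

## The mathematics (refereed), and why the real clause implies FULL semiregularity

* [BuchweitzFlenner2008HH] (R.-O. Buchweitz, H. Flenner, *The global decomposition theorem for Hochschild (co-)homology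
  of singular spaces via the Atiyah–Chern character*, Adv. Math. 217 (2008) 243–281), Prop. 6.4.4 (held text p. 32,
  L49–78; located and re-read by theory seat 2 and red
  team 2, R118–R125): for a perfect complex `F` on a complex space `X` and the semiregularity map
  `σ_F : Ext²_X(F, F) → ⊕_q H^{q+2}(X, Ω^q_X)` of [BuchweitzFlenner2003] Def. 4.1, the composite of `σ_F` with the
  contraction `c_F : HT²(X) := ⊕_{a+b=2} H^a(X, Λ^b T_X) → Ext²_X(F, F)`, `ξ ↦ ξ ⌟ exp(-At_F)`, is the contraction
  AGAINST THE CHERN CHARACTER: `σ_F (c_F ξ) = ξ ⌟ ch(F)` (there `σ_F` is Hochschild-valued; on a SMOOTH `X` it is the `⊕_q H^{q+2}(Ω^q)`-valued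
  `σ` of [BuchweitzFlenner2003] Def. 4.1 through the HKR decomposition — [BuchweitzFlenner2008HH] Thm. 6.4.2 and Rem. 6.4.3,
  held text p. 31 L41–97; abelian varieties are smooth). CONSEQUENCE (3 lines; theory seat 2's leg (β) of record,
  `theory/TH2-ASSEMBLY-NOTE-2PAGE.md` §0 (I2)(β)): with `r(F) := rank(ξ ↦ ξ ⌟ ch F)` one has
  `r(F) = rank(σ_F ∘ c_F) ≤ rank σ_F ≤ dim Ext²(F, F)`, so **`dim Ext²(F, F) ≤ r(F)` forces equality throughout:
  `σ_F` is INJECTIVE (full Buchweitz–Flenner semiregularity) and `c_F` is surjective.** The census certifies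
  `r(𝓔) = 18 = dim Ext²(𝓔, 𝓔)` for the fourfold object `𝓔 = Φ(I_{p×X ∪ X×q}) ⊗ M_B` at `d = 3, 7, 11, 15` (two
  independent codes) and `r = 48 = dim Ext²` for the theta-secant sixfold objects (four codes).
* On an ABELIAN variety `A` of dimension `g` everything is constant-coefficient (Mumford, *Abelian Varieties*, §1
  and §4 (iii): `T_A ≅ 𝒪_A ⊗ T₀`, `H^q(A, Ω^p) ≅ Λ^q H̄ ⊗ Λ^p Ω₀`; [LangeBirkenhake1992] §1.4): with
  `V := H¹(A(ℂ); ℂ) = V^{1,0} ⊕ V^{0,1}`, `V^{1,0} = H⁰(Ω¹) = T₀^∨`, one has `H^a(A, Λ^b T_A) = Λ^a V^{0,1} ⊗ Λ^b T₀`,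
  `H^•(A(ℂ); ℂ) = Λ^• V` (cup product; the tree's PROVED `abelianVarietyCohomologyExteriorH1_holds`), and `ξ ⌟ -`
  is the exterior-algebra operation: a class `q ∈ V^{0,1}` acts by (cup = wedge) multiplication, a vector
  `θ ∈ T₀ = (V^{1,0})^∨` — equivalently a linear form on `V` KILLING `V^{0,1}` — acts by the interior product
  (the antiderivation `ι_θ` with `ι_θ(v) = θ(v)`, Mathlib `CliffordAlgebra.contractLeft` on `Λ V`), and
  `HT²(A)` is spanned by the decomposable operators `q₁ ∧ q₂ ∧ -`, `q ∧ ι_θ(-)`, `ι_{θ₁} ι_{θ₂}(-)`. Signs and the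
  scalars of `exp` do not change ranks; nor does the normalisation of the Chern character: the tree's `C.ch_p`
  (Betti, `ChernCharacterBetti`) and the Atiyah-class `ch_p ∈ H^p(Ω^p)` of [BF03]/[BF08] differ by a
  degree-GEOMETRIC factor `c^p` (`c` a universal non-zero constant), and `ξ ↦ ξ ⌟ Σ_p c^p κ_p` is conjugate to
  `ξ ↦ ξ ⌟ Σ_p κ_p` by the automorphisms `c^b` on `H^a(Λ^b T)` and `c^s` on `H^{s,s+2}` (a contribution of type
  `(a, b)` against `κ_p` lands in bidegree `(p - b, p + a)`); the tree's `ChernCharacterBetti` pins `ch` on vector bundles up to exactly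
  such a `λ^p`, and `chPerfect` (alternating sum) is `λ`-compatible termwise, so `contractionRank A (ch E)` is well defined up to this
  conjugation for every `C`. HENCE `r(F) = contractionRank A (ch F)` as defined
  below (the rank of the span of these operators applied to the total class `Σ_p ch_p(F) ∈ Λ V`).
* `Ext^i(F, F) = Hom_{D(A)}(F, F[i])` in Mathlib's derived category of `𝒪_A`-modules, a `ℂ`-vector space by the
  tree's `instLinearOverBase` and Mathlib's `DerivedCategory.instLinear` (kernel datum: theory seat 2's probe
  `theory/th2-tier2/PROBE-TH2-TIER2-ExtRank.lean`); dimensions are CARDINAL ranks (`Module.rank`), so that no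
  clause is vacuously satisfied by a `finrank = 0` junk value on an infinite-dimensional group.

## Kernel content and honesty clause

* REAL definitions: `extRank X₀ E n` (`rank_ℂ Hom_{D(X₀)}(E, E⟦n⟧)`), `totalExteriorClass A κ`
  (`Σ_{p ≤ g} κ_p ∈ Λ H¹`), `contractionSet A κ` / `contractionRank A κ`, the admissibility notion
  `rankAdmissible C` («`{1..n} ⊆ I`; `Ext^{<0} = 0`; `Hom = ℂ`; `X₀ ≅ A.X` for an abelian variety `A` of
  dimension `n`; `rank Ext² ≤ contractionRank A (ch E)`»), and `PerfectComplexRankTransfer C`.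
* PROVED: `contractionRank A 0 = 0` and `extRank_two_eq_zero_of_rankAdmissible_of_ch_eq_zero` (the clause is
  not vacuous in `r`: with vanishing Chern character it forces `Ext² = 0`); monotonicity bookkeeping.
* NOT PROVED and NOT provable in the tree today: `rankAdmissible ⟹ σ injective` (the semiregularity map of a
  perfect complex has no carrier — cell records `theory/TH1-PERFECT-COMPLEX.md` §4(c),
  `theory/TH2-PERRY-ASSEMBLY-TYPABILITY.md` §2 K2); it is the 3-line consequence of [BF08] Prop. 6.4.4 above, ON
  PAPER. Therefore `PerfectComplexRankTransfer C` is implied ON PAPER by the printed transfer for semiregular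
  perfect complexes — Perry arXiv:2604.00511 Thm. 1.1 (second bullet, `B₀ = 0`; preprint) / the refereed chain
  [Perry2022] Prop. 8.1 + (L1)–(L6) of `theory/TH2-ASSEMBLY-NOTE-2PAGE.md` §3 (local form: derivation in the
  module docstring of `PerfectComplexDoor.lean`) — i.e. it is an assumption OF PRINTED STRENGTH (the object class
  is SMALLER than the printed one), not of variational-Hodge strength (theory seat 2, bus 11:56:00Z; red team 1
  rule V9-A2). The kernel certifies none of this paragraph.
-/

noncomputable section

open CategoryTheory CategoryTheory.Limits AlgebraicGeometry
open _root_.Topology _root_.Filter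
open Literature.AlgebraicGeometry.Motives Literature.AlgebraicGeometry.HodgeTheory
open Literature.AlgebraicGeometry.KTheory
open Literature.AlgebraicTopology.SingularHomology
open CliffordAlgebra (contractLeft)

namespace Summit.Ventures.HSemireg

/-! ### 1. `Ext` ranks of a complex in Mathlib's derived category -/

section ExtRank

variable (X₀ : SchemeOver ℂ)

/-- **`rank_ℂ Ext^n_{D(X₀)}(E, E) = rank_ℂ Hom_{D(X₀)}(E, E⟦n⟧)`** for a cochain complex `E` of `𝒪_{X₀}`-modules on
a `ℂ`-scheme `X₀`, in Mathlib's derived category `DerivedCategory X₀.left.Modules` (constructed instance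
`HasDerivedCategory.standard`), with the `ℂ`-linear structure induced from the tree's `instLinearOverBase`
(`Γ(X₀, 𝒪) ⊇ ℂ` acts on morphisms) through Mathlib's `DerivedCategory.instLinear`. A CARDINAL (`Module.rank`),
so that «`extRank ≤ r`» is never vacuously true. The ambient category is the derived category of ALL `𝒪_{X₀}`-modules — the one in
which [BuchweitzFlenner2003] §1/§4 and [Lieblich2006] place `Ext^i(E, E)` of a perfect complex (for a bounded complex of vector bundles
on a noetherian scheme these are the usual hyperext groups — `D^b(Coh X) → D(Mod 𝒪_X)` is fully faithful, Görtz–Wedhorn II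
Thm. 22.42 — and `Ext^i` of [Hartshorne1977] III.6 when `E` is a single sheaf). (Idiom of theory seat 2's probe
`PROBE-TH2-TIER2-ExtRank.lean`.) [cite: Hartshorne1977, III.6 (Ext as derived functors on Mod(X))]
[cite: GortzWedhorn2023, Thm. 22.42] [cite: BuchweitzFlenner2003, §1 («the obstructions … lie in Ext²_X(F, F)») and Def. 4.1] -/
def extRank (E : CochainComplex X₀.left.Modules ℤ) (n : ℤ) : Cardinal :=
  letI := HasDerivedCategory.standard X₀.left.Modules
  Module.rank ℂ (DerivedCategory.Q.obj E ⟶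
    (shiftFunctor (DerivedCategory X₀.left.Modules) n).obj (DerivedCategory.Q.obj E))

end ExtRank

/-! ### 2. The polyvector contraction rank on an abelian variety -/

section Contraction

variable (A : AbelianVariety ℂ)

/-- The set `V^{0,1} = H^{0,1} ⊆ H¹(A(ℂ); ℂ)` of degree-one classes of Hodge type `(0, 1)` (a complex subspace,
`hodgeZeroOne`; here only the underlying set is needed). It is the GENUINE `H^{0,1}` for every abelian variety `A` — never
empty by absence of a model: the tree proves `nonempty_hodgeModel_abelianVariety` (a Hodge model of `A` exists) and the type
is model-independent (`isOfHodgeType_iff_mem_hodgePQ`); this matters, since an empty set here would enlarge `vectorFieldSet`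
and the contraction rank, i.e. WEAKEN the admissibility clause below. [cite: VoisinHodgeI2002, §7.1.1]
[cite: LangeBirkenhake1992, Thm. 1.4.1] -/
def hodgeZeroOneSet : Set (complexBetti A.X 1) :=
  {q | IsOfHodgeType A.dim A.X 1 0 1 q}

/-- The linear forms on `H¹(A(ℂ); ℂ)` KILLING `H^{0,1}` — under `H¹ = V^{1,0} ⊕ V^{0,1}` these are exactly the
forms on `V^{1,0} = H⁰(A, Ω¹)`, i.e. the space `T₀ = H⁰(A, T_A) = (V^{1,0})^∨` of (constant) vector fields, which
act on forms by interior product and kill the `(0,1)`-part. [cite: MumfordAV1970, §1 and §4 (iii)]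
[cite: LangeBirkenhake1992, §1.4] -/
def vectorFieldSet : Set (Module.Dual ℂ (complexBetti A.X 1)) :=
  {θ | ∀ q ∈ hodgeZeroOneSet A, θ q = 0}

/-- **The total class `Σ_{p ≤ g} κ_p` read in the exterior algebra `Λ H¹(A(ℂ); ℂ) = H^•(A(ℂ); ℂ)`** through the
tree's PROVED comparison isomorphisms `Λ^d H¹ ≃ H^d` (`abelianVarietyCohomologyExteriorH1_holds.equiv`, cup
product) — for a family `κ = (κ_p)_p`, `κ_p ∈ H^{2p}(A(ℂ); ℂ)` (degrees `2p > 2g` carry nothing: `H^{2p} = 0`).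
[cite: LangeBirkenhake1992, Lemma 1.1.17 and Exercise 1.1.6 (7)] -/
def totalExteriorClass (κ : ∀ p : ℕ, complexBetti A.X (2 * p)) : ExteriorAlgebra ℂ (complexBetti A.X 1) :=
  ∑ p ∈ Finset.range (A.dim + 1),
    (⋀[ℂ]^(2 * p) (complexBetti A.X 1)).subtype
      ((abelianVarietyCohomologyExteriorH1_holds.equiv A (2 * p)).symm (κ p))

/-- **The contractions `ξ ⌟ κ`, `ξ ∈ HT²(A)` decomposable**, as elements of `Λ H¹`: with `x = Σ_p κ_p`,
`q₁ ∧ q₂ ∧ x` (`ξ ∈ H²(𝒪_A) = Λ² V^{0,1}`), `q ∧ ι_θ x` (`ξ ∈ H¹(T_A) = V^{0,1} ⊗ T₀`), `ι_{θ₁} ι_{θ₂} x`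
(`ξ ∈ H⁰(Λ² T_A) = Λ² T₀`); `ι_θ` = Mathlib's `CliffordAlgebra.contractLeft θ` on `Λ V = CliffordAlgebra 0`. Decomposable tensors
span each summand of `HT²(A) = Λ² V^{0,1} ⊕ (V^{0,1} ⊗ T₀) ⊕ Λ² T₀` and `ξ ↦ ξ ⌟ x` is linear, so the span of this set IS the image
of `HT²(A) → Λ V`, `ξ ↦ ξ ⌟ x` (its rank = the rank of that map).
[cite: BuchweitzFlenner2008HH, Prop. 6.4.4 (the contraction ξ ⌟ ch F)] [cite: MumfordAV1970, §4 (iii)] -/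
def contractionSet (κ : ∀ p : ℕ, complexBetti A.X (2 * p)) : Set (ExteriorAlgebra ℂ (complexBetti A.X 1)) :=
  {y | ∃ q₁ ∈ hodgeZeroOneSet A, ∃ q₂ ∈ hodgeZeroOneSet A,
      y = ExteriorAlgebra.ι ℂ q₁ * (ExteriorAlgebra.ι ℂ q₂ * totalExteriorClass A κ)} ∪
  {y | ∃ q ∈ hodgeZeroOneSet A, ∃ θ ∈ vectorFieldSet A,
      y = ExteriorAlgebra.ι ℂ q * contractLeft θ (totalExteriorClass A κ)} ∪
  {y | ∃ θ₁ ∈ vectorFieldSet A, ∃ θ₂ ∈ vectorFieldSet A,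
      y = contractLeft θ₁ (contractLeft θ₂ (totalExteriorClass A κ))}

/-- **The polyvector contraction rank `r(A, κ) := rank(HT²(A) → H^•(A), ξ ↦ ξ ⌟ κ)`** — the dimension of the span
of the decomposable contractions (`contractionSet`), a CARDINAL. For `κ = ch(F)` of a perfect complex `F` this
is the rank of `ξ ↦ ξ ⌟ ch(F) = σ_F(ξ ⌟ exp(-At_F))`, hence `≤ rank σ_F ≤ dim Ext²(F, F)`.
[cite: BuchweitzFlenner2008HH, Prop. 6.4.4] -/
def contractionRank (κ : ∀ p : ℕ, complexBetti A.X (2 * p)) : Cardinal :=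
  Module.rank ℂ (Submodule.span ℂ (contractionSet A κ))

/-- The total class of the zero family is `0`. [folklore] -/
@[simp]
theorem totalExteriorClass_zero : totalExteriorClass A (fun _ => 0) = 0 := by
  unfold totalExteriorClass
  exact Finset.sum_eq_zero fun p _ => by rw [map_zero, map_zero]

/-- Every contraction of the zero family is `0`. [folklore] -/
theorem contractionSet_zero_subset : contractionSet A (fun _ => 0) ⊆ {0} := by
  intro y hy
  simp only [contractionSet, totalExteriorClass_zero, Set.mem_union, Set.mem_setOf_eq, mul_zero, map_zero]
    at hy
  rcases hy with (⟨_, _, _, _, rfl⟩ | ⟨_, _, _, _, rfl⟩) | ⟨_, _, _, _, rfl⟩ <;> rfl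

/-- **`r(A, 0) = 0`**: the contraction rank of the zero family vanishes (so the clause «`rank Ext² ≤ r`» of
`rankAdmissible` is NOT vacuous in `r`). [folklore] -/
theorem contractionRank_zero : contractionRank A (fun _ => 0) = 0 := by
  have h : Submodule.span ℂ (contractionSet A (fun _ => 0)) = ⊥ := by
    rw [Submodule.span_eq_bot]
    intro y hy
    exact Set.mem_singleton_iff.mp (contractionSet_zero_subset A hy)
  rw [contractionRank, h]
  exact rank_bot ℂ _

end Contraction

/-! ### 2b. The linear-algebra skeleton of leg (β): «`dim V ≤ rank(σ ∘ c)` forces `σ` injective and `c` surjective» -/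

section Skeleton

variable {K : Type*} [Field K] {U V W : Type*} [AddCommGroup U] [Module K U] [AddCommGroup V] [Module K V]
  [AddCommGroup W] [Module K W]

/-- **Leg (β), abstract form** (kernel-checked linear algebra; the geometric identification `σ ∘ c = (ξ ↦ ξ ⌟ ch F)`
is [BF08] Prop. 6.4.4 and is NOT formalised): for linear maps `c : U → V`, `σ : V → W` with `V` finite-dimensional,
if `dim V ≤ dim range(σ ∘ c)` then `σ` is INJECTIVE and `c` is SURJECTIVE — since
`dim range(σ ∘ c) ≤ dim range c ≤ dim V` and `dim range(σ ∘ c) ≤ dim range σ = dim V - dim ker σ`.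
(With `U = HT²(X)`, `V = Ext²(F, F)`, `W = ⊕_q H^{q+2}(Ω^q)`, `c = ⌟ exp(-At F)`, `σ` the semiregularity map: the
census inequality `dim Ext² ≤ r` gives full semiregularity and `HT² ↠ Ext²`.) [cite: BuchweitzFlenner2008HH, Prop. 6.4.4] -/
theorem injective_and_surjective_of_finrank_le_finrank_range_comp [Module.Finite K V] (c : U →ₗ[K] V)
    (σ : V →ₗ[K] W) (h : Module.finrank K V ≤ Module.finrank K (LinearMap.range (σ ∘ₗ c))) :
    Function.Injective σ ∧ Function.Surjective c := by
  have hcomp : LinearMap.range (σ ∘ₗ c) = (LinearMap.range c).map σ := LinearMap.range_comp c σ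
  -- `range(σ ∘ c) ≤ range σ`, so `dim V ≤ dim range σ`, and rank–nullity kills `ker σ`
  have hσ : Module.finrank K V ≤ Module.finrank K (LinearMap.range σ) := by
    refine h.trans (Submodule.finrank_mono ?_)
    rw [hcomp]
    exact LinearMap.map_le_range
  have hker : Module.finrank K (LinearMap.ker σ) = 0 := by
    have := LinearMap.finrank_range_add_finrank_ker σ
    omega
  refine ⟨LinearMap.ker_eq_bot.mp (Submodule.finrank_eq_zero.mp hker), ?_⟩
  -- `dim range(σ ∘ c) ≤ dim range c ≤ dim V`, so `range c = ⊤`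
  have hc : Module.finrank K V ≤ Module.finrank K (LinearMap.range c) := by
    refine h.trans ?_
    rw [hcomp]
    exact Submodule.finrank_map_le σ (LinearMap.range c)
  have htop : LinearMap.range c = ⊤ :=
    Submodule.eq_top_of_finrank_eq (le_antisymm (Submodule.finrank_le _) hc)
  exact LinearMap.range_eq_top.mp htop

end Skeleton

/-! ### 3. The real admissibility notion and the named transfer statement -/

section Door

/-- **The rank admissibility notion** (REAL, every conjunct a definition of the tree / Mathlib): a cochain
complex `E` of `𝒪_{X₀}`-modules is admissible for `(n, X₀, I)` iff
(i) `I` contains every Chern degree `1 ≤ p ≤ n` (the transfer's Hodge condition is then imposed in every degree,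
as the local half (L5) of the refereed chain needs);
(ii) `Ext^{<0}_{D(X₀)}(E, E) = 0` (Lieblich's «universally gluable»: `E` is a point of the moduli of perfect
complexes) and `Hom_{D(X₀)}(E, E) = ℂ` (simple) — as CARDINAL ranks;
(iii) `X₀ ≅ A.X` for an abelian variety `A` of dimension `n`, `E` is a bounded complex of vector bundles, and
`rank_ℂ Ext²_{D(X₀)}(E, E) ≤ r(A, ch E)`, the polyvector contraction rank of its Chern character (transported
to `A`; a `Cardinal.lift` matches the universes of the two ranks). By [BF08] Prop. 6.4.4, (iii) implies that the FULL semiregularity map of `E` is injective (module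
docstring; NOT a kernel statement). The cell's fourfold object satisfies (i)–(iii) by value:
`Ext^• = (1, 8, 18, 8, 1)`, `Ext^{<0} = 0`, `r = 18` (`theory/TH2-ASSEMBLY-NOTE-2PAGE.md` §0 (I1)–(I2)).
[cite: BuchweitzFlenner2008HH, Prop. 6.4.4] [cite: Lieblich2006, Thm. 4.2.1 (universally gluable)]
[cite: Perry2026Semiregularity, Thm. 1.1 (hypotheses «semiregular», «Ext^{<0} = 0»)] -/
def rankAdmissible (C : ChernCharacterBetti) : AdmissibilityNotion := fun n X₀ I E =>
  (∀ p : ℕ, 1 ≤ p → p ≤ n → p ∈ I) ∧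
    (∀ k : ℤ, k < 0 → extRank X₀ E k = 0) ∧ extRank X₀ E 0 = 1 ∧
      ∃ (A : AbelianVariety ℂ) (e : A.X ≅ X₀) (hE : IsBoundedVBComplex E), A.dim = n ∧
        extRank X₀ E 2 ≤ Cardinal.lift.{1}
          (contractionRank A fun p => complexBetti.map e.hom (2 * p) (chPerfect C X₀ E hE.isFiniteLocallyFree p))

/-- **Non-vacuity in `r`**: an admissible complex whose Chern character vanishes (after transport to `A`) has
`Ext²(E, E) = 0` — the rank clause then reads `rank Ext² ≤ r(A, 0) = 0`. [folklore] -/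
theorem extRank_two_eq_zero_of_rankAdmissible_of_ch_eq_zero (C : ChernCharacterBetti) {n : ℕ}
    {X₀ : SchemeOver ℂ} {I : Finset ℕ} {E : CochainComplex X₀.left.Modules ℤ}
    (h : rankAdmissible C n X₀ I E)
    (hch : ∀ (hE : IsBoundedVBComplex E) (p : ℕ), chPerfect C X₀ E hE.isFiniteLocallyFree p = 0) :
    extRank X₀ E 2 = 0 := by
  obtain ⟨-, -, -, A, e, hE, -, hle⟩ := h
  have h0 : (fun p => complexBetti.map e.hom (2 * p) (chPerfect C X₀ E hE.isFiniteLocallyFree p)) =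
      fun _ => (0 : complexBetti A.X (2 * _)) := by
    funext p
    rw [hch hE p, map_zero]
  rw [h0, contractionRank_zero, Cardinal.lift_zero] at hle
  exact nonpos_iff_eq_zero.mp hle

/-- The object class of the rank door: `perfectObjClass C (rankAdmissible C)`, i.e. «`κ|_I = ch(E)|_I` for a
bounded complex of vector bundles `E` on `X₀ ≅ A.X` with `Ext^{<0}(E,E) = 0`, `Hom(E,E) = ℂ` and
`rank Ext²(E,E) ≤ r(A, ch E)`», `{1..n} ⊆ I`. [cite: BuchweitzFlenner2008HH, Prop. 6.4.4]
[cite: Perry2026Semiregularity, Thm. 1.1 (hypotheses)] -/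
abbrev rankObjClass (C : ChernCharacterBetti) (n : ℕ) (X₀ : SchemeOver ℂ) (I : Finset ℕ)
    (κ : ∀ p : ℕ, complexBetti X₀ (2 * p)) : Prop :=
  perfectObjClass C (rankAdmissible C) n X₀ I κ

/-- **The perfect-complex transfer over the REAL rank class** — `PerfectComplexVariationalHodge C (rankAdmissible C)`:
along a smooth projective family over a smooth base, the Chern character (degrees `p ∈ I ⊇ {1..n}`) of a bounded
complex of vector bundles `E` on a fibre `X₀ ≅ A.X` (an abelian variety of dimension `n`) with `Ext^{<0}(E,E) = 0`,
`Hom(E,E) = ℂ` and `rank Ext²(E,E) ≤ r(A, ch E)`, if it stays Hodge along the paths of a cohomologically locally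
trivial `U`, stays ALGEBRAIC on the fibres near `X₀` (exact binders: `PerfectComplexVariationalHodge`). STATUS: an
ASSUMPTION BY NAME of the venture (hypothesis of the assembly theorem), OF PRINTED STRENGTH: by [BF08] Prop. 6.4.4
the class is STRICTLY contained in «semiregular perfect complexes with `Ext^{<0} = 0`» (the clause also forces
`HT² ↠ Ext²`), for which the statement is the
local form of Perry's Thm. 1.1 (second bullet, `B₀ = 0`; preprint) and, refereed, of [Perry2022] Prop. 8.1 + the
local half (L1)–(L6) ([Lieblich2006] 4.2.1; [Pridham2024Semiregularity] Lemma 1.8, Cor. 2.25, Rem. 2.27, Rem. 2.21;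
[BuchweitzFlenner2003] Rem. 4.7 (1); [Deligne1968] Thm. 5.5) — derivation of the local form in the module
docstring of `PerfectComplexDoor.lean`. No declaration of the tree discharges it (the semiregularity map of a
complex has no carrier). [claim: Perry2026Semiregularity, status: under-review]
[cite: BuchweitzFlenner2008HH, Prop. 6.4.4] [cite: Perry2022, Prop. 8.1]
[cite: Pridham2024Semiregularity, Cor. 2.25, Rem. 2.27, Rem. 2.21, Lemma 1.8] [cite: Lieblich2006, Thm. 4.2.1]
[cite: BuchweitzFlenner2003, Def. 4.1 and Rem. 4.7 (1)] [cite: Deligne1968, Thm. 5.5] -/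
def PerfectComplexRankTransfer (C : ChernCharacterBetti) : Prop :=
  PerfectComplexVariationalHodge C (rankAdmissible C)

/-- Unfolding: the rank transfer is the schema of `PerfectComplexDoor.lean` at `Adm := rankAdmissible C`.
[folklore] -/
theorem perfectComplexRankTransfer_iff (C : ChernCharacterBetti) :
    PerfectComplexRankTransfer C ↔ PerfectComplexVariationalHodge C (rankAdmissible C) :=
  Iff.rfl

/-- **Any transfer statement for a WIDER admissibility notion serves the rank class**: if `Adm` admits every
rank-admissible complex (e.g. a future typed «`σ_E` injective ∧ `Ext^{<0} = 0`», which contains the rank class by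
[BF08] Prop. 6.4.4), then `PerfectComplexVariationalHodge C Adm ⟹ PerfectComplexRankTransfer C`.
[cite: BuchweitzFlenner2008HH, Prop. 6.4.4] -/
theorem perfectComplexRankTransfer_of_wider {C : ChernCharacterBetti} {Adm : AdmissibilityNotion}
    (hle : ∀ n X₀ I E, rankAdmissible C n X₀ I E → Adm n X₀ I E) (h : PerfectComplexVariationalHodge C Adm) :
    PerfectComplexRankTransfer C :=
  h.anti hle

end Door

/-! ### 4. The admissibility notion is a property of the PERFECT COMPLEX (quasi-isomorphism invariance) -/

section Invariance

variable (X₀ : SchemeOver ℂ)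

/-- **`Ext` ranks are invariants of the object of the derived category**: a quasi-isomorphism `φ : E ⟶ F` of cochain
complexes becomes an isomorphism `Q φ` in `D(Mod 𝒪_{X₀})` (Mathlib `DerivedCategory.isIso_Q_map_iff_quasiIso`), and
conjugating by it is a `ℂ`-linear equivalence `Hom(Q E, Q E⟦n⟧) ≃ Hom(Q F, Q F⟦n⟧)` (`Linear.homCongr`), so the ranks agree.
[cite: Hartshorne1977, III.6 (Ext as derived functors on Mod(X))] -/
theorem extRank_eq_of_quasiIso {E F : CochainComplex X₀.left.Modules ℤ} (φ : E ⟶ F) [QuasiIso φ] (n : ℤ) :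
    extRank X₀ E n = extRank X₀ F n := by
  letI := HasDerivedCategory.standard X₀.left.Modules
  haveI : IsIso (DerivedCategory.Q.map φ) :=
    (DerivedCategory.isIso_Q_map_iff_quasiIso (C := X₀.left.Modules) φ).mpr inferInstance
  exact (Linear.homCongr ℂ (asIso (DerivedCategory.Q.map φ))
    ((shiftFunctor (DerivedCategory X₀.left.Modules) n).mapIso (asIso (DerivedCategory.Q.map φ)))).rank_eq

variable {X₀}

/-- **Rank-admissibility is invariant under quasi-isomorphism** of bounded complexes of vector bundles: the `Ext` ranks
are (`extRank_eq_of_quasiIso`) and so is the Chern character (`chPerfect_eq_of_quasiIso`, the tree's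
`eulerChar_eq_of_quasiIso`), hence the contraction rank. So `rankAdmissible C n X₀ I` is a predicate on the perfect
complex `E ∈ D(X₀)`, not on the chosen locally free model — as the printed hypotheses («`E₀ ∈ D_perf(X₀)` semiregular
with `Ext^{<0}(E₀, E₀) = 0`») are. [cite: Perry2026Semiregularity, Thm. 1.1 (hypotheses on E₀ ∈ D_perf(X₀))]
[cite: BuchweitzFlenner2008HH, Prop. 6.4.4] -/
theorem rankAdmissible_iff_of_quasiIso (C : ChernCharacterBetti) {n : ℕ} {I : Finset ℕ}
    {E F : CochainComplex X₀.left.Modules ℤ} (φ : E ⟶ F) [QuasiIso φ] (hE : IsBoundedVBComplex E)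
    (hF : IsBoundedVBComplex F) : rankAdmissible C n X₀ I E ↔ rankAdmissible C n X₀ I F := by
  have hch : ∀ p : ℕ, chPerfect C X₀ E hE.isFiniteLocallyFree p = chPerfect C X₀ F hF.isFiniteLocallyFree p :=
    fun p => chPerfect_eq_of_quasiIso C X₀ hE hF φ p
  have hext : ∀ k : ℤ, extRank X₀ E k = extRank X₀ F k := fun k => extRank_eq_of_quasiIso X₀ φ k
  constructor
  · rintro ⟨hI, hneg, h0, A, e, _, hdim, hle⟩
    have key : (fun p => complexBetti.map e.hom (2 * p) (chPerfect C X₀ F hF.isFiniteLocallyFree p)) =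
        fun p => complexBetti.map e.hom (2 * p) (chPerfect C X₀ E hE.isFiniteLocallyFree p) :=
      funext fun p => by rw [hch p]
    refine ⟨hI, fun k hk => (hext k) ▸ hneg k hk, (hext 0) ▸ h0, A, e, hF, hdim, ?_⟩
    rw [key, ← hext 2]
    exact hle
  · rintro ⟨hI, hneg, h0, A, e, _, hdim, hle⟩
    have key : (fun p => complexBetti.map e.hom (2 * p) (chPerfect C X₀ E hE.isFiniteLocallyFree p)) =
        fun p => complexBetti.map e.hom (2 * p) (chPerfect C X₀ F hF.isFiniteLocallyFree p) :=
      funext fun p => by rw [hch p]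
    refine ⟨hI, fun k hk => (hext k).symm ▸ hneg k hk, (hext 0).symm ▸ h0, A, e, hE, hdim, ?_⟩
    rw [key, hext 2]
    exact hle

/-- Consequently the object class of the rank door does not see the model: quasi-isomorphic bounded complexes of vector
bundles define the same instance of `rankObjClass C n X₀ I κ`. [cite: BuchweitzFlenner2008HH, Prop. 6.4.4] -/
theorem rankObjClass_of_quasiIso (C : ChernCharacterBetti) {n : ℕ} {I : Finset ℕ}
    {κ : ∀ p : ℕ, complexBetti X₀ (2 * p)} {E F : CochainComplex X₀.left.Modules ℤ} (φ : E ⟶ F) [QuasiIso φ]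
    (hE : IsBoundedVBComplex E) (hF : IsBoundedVBComplex F) (hA : rankAdmissible C n X₀ I E)
    (hκ : ∀ p ∈ I, κ p = chPerfect C X₀ E hE.isFiniteLocallyFree p) : rankObjClass C n X₀ I κ :=
  ⟨F, hF, (rankAdmissible_iff_of_quasiIso C φ hE hF).mp hA,
    fun p hp => (hκ p hp).trans (chPerfect_eq_of_quasiIso C X₀ hE hF φ p)⟩

end Invariance

end Summit.Ventures.HSemireg

end
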